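import Literature.NumberTheory.Automorphic.UnitaryGroupKernelFiniteSum
import Literature.NumberTheory.Automorphic.UnitaryGroupBorelSemidirect
import HarnessLib

/-!
# The rational Levi decomposition `B(F) = T(F) N(F)` of `U(J_N)` and the Borel sum fibred over `T(F)`
(Rogawski, *Automorphic Representations of Unitary Groups in Three Variables* (1990), §1.10 `B = MN`,
§2.2 p. 13: `K_P(x, y) = Σ_{γ ∈ M_P} ∫_{𝐍_P} f(x⁻¹ γ n y) dn`, the sum over the rational Levi `M_P = T`)

Topic `NumberTheory/Automorphic`; namespace `Literature.NumberTheory.Automorphic.UnitaryGroup`. THEOREMS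
ONLY over accepted tree modules: no definition, no named fact, no `sorry`, no instance, no notation.
Setting: Mok's `U_{E/F}(N) = U(J_N)` (★ `UnitaryGroup.quasiSplit F E c N`), its adelic Borel pair
`B(𝔸_F) = T(𝔸_F) ⋉ N(𝔸_F)` (★ `borelAdelic`, `torusAdelic`, `adelicUnipotent`, ★ `torusPart` of
`UnitaryGroupBorelSemidirect`) and the rational points `B(F)` (★ `arithmeticBorel`), `T(F)`
(★ `rationalTorus`), `N(F)` (★ `rationalUnipotent`).

* §1 **`B(F) = T(F) N(F)`**: the torus part of a RATIONAL Borel element is rational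
  (`torusPart_mem_arithmeticSubgroup`: `b ∈ B(F)` is the image of a rational unitary matrix, upper
  triangular since `E → 𝔸_E` is injective, whose diagonal is again unitary —
  ★ `exists_unipotent_mul_torus_of_mem_borelOfForm` over `E`), so is its unipotent part
  (`torusPart_inv_mul_mem_arithmeticSubgroup`); `torusPart (t m) = t`; and
  `exists_equiv_arithmeticBorel_prod`: a bijection `e : B(F) ≃ T(F) × N(F)` with `e⁻¹(t, n) = t n`
  (`T ∩ N = 1`, ★ `torusAdelic_inf_adelicUnipotent_eq_bot`).
* §2 `borelSum_eq_tsum_prod`, **`borelSum_eq_tsum_tsum`** — the rational Borel sum ★ `borelSum` of the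
  trace-formula letters (★ `UnitaryGroupArthurTruncatedKernel`) fibres over the rational torus:
  `Σ_{β ∈ B(F)} f(x⁻¹ β z) = Σ_{t ∈ T(F)} Σ_{n ∈ N(F)} f(x⁻¹ t n z)` for `f` of compact support (finite
  sums, ★ `finite_support_borelSum_term`; `finite_support_borelSum_prod_term`).
* §3 **`finite_setOf_rationalTorus_meets_support`** — for `f` of compact support and `x, y` only
  FINITELY many `t ∈ T(F)` have `f(x⁻¹ t m y) ≠ 0` for some `m ∈ N(𝔸_F)`: such `t` are torus parts
  (★ `continuous_torusPart`) of the compact `B(𝔸_F) ∩ x·supp(f)·y⁻¹` (★ `isClosed_borelAdelic`) lying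
  in the discrete `G(F)` (★ `finite_setOf_mem_arithmeticSubgroup_of_isCompact`). This is the
  finiteness of the `γ ∈ M_P`-sum in Rogawski's `K_P` for `f ∈ C_c` and the input of the companion
  `UnitaryGroupKernelBorelTorusFibration` (`K_B = ν(𝓕)⁻¹ Σ_{T(F)} ∫_{N(𝔸_F)}`).

## References

* J. D. Rogawski, *Automorphic Representations of Unitary Groups in Three Variables*, Annals of
  Mathematics Studies 123 (1990), §1.10, §2.2 (p. 13) [Rogawski1990].
* P. Garrett, *Modern Analysis of Automorphic Forms by Example* (2018), §2.3, §2.10 [Garrett2018].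
-/

noncomputable section

open NumberField IsDedekindDomain Topology Set
open scoped MatrixGroups

namespace Literature.NumberTheory.Automorphic

namespace UnitaryGroup

variable {F E : Type} [Field F] [NumberField F] [Field E] [NumberField E] [Algebra F E]
  {c : E ≃ₐ[F] E} {N : ℕ}

/-! ## §1 The rational Levi decomposition `B(F) = T(F) N(F)` -/

/-- **The torus part of a rational Borel element is rational**: for `b ∈ B(F) = B(𝔸_F) ∩ G(F)` the
diagonal part `torusPart b = diag(b₁₁, …, b_NN)` lies in `G(F)` (so in `T(F)`): `b` is the image of a
rational unitary matrix `γ`, which is upper triangular (`E → 𝔸_E` is injective), and the diagonal of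
such a matrix is again unitary (★ `exists_unipotent_mul_torus_of_mem_borelOfForm` over `E`; Rogawski
(1990), §1.10, `B = MN` over `F`). [cite: Rogawski1990, §1.10] -/
theorem torusPart_mem_arithmeticSubgroup {b : borelAdelic F E c N}
    (hb : (b : (quasiSplit F E c N).Adelic) ∈ (quasiSplit F E c N).arithmeticSubgroup) :
    ((torusPart b : borelAdelic F E c N) : (quasiSplit F E c N).Adelic) ∈
      (quasiSplit F E c N).arithmeticSubgroup := by
  obtain ⟨γ, hγ⟩ := hb
  -- the rational matrix `γ` is upper triangular: its sub-diagonal entries vanish in `𝔸_E`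
  have hB : (γ.1 : GL (Fin N) E) ∈ borelOfForm (c : E →+* E) N := by
    refine ⟨γ.2, fun i j hij => ?_⟩
    have h := (mem_borelAdelic_iff _).1 b.2 hij
    rw [← hγ] at h
    exact (map_eq_zero_iff _ (AdeleRing.algebraMap_injective (𝓞 E) E)).1 h
  obtain ⟨-, -, d, hdT, hd, -⟩ := exists_unipotent_mul_torus_of_mem_borelOfForm hB
  refine ⟨⟨glDiagonal N E d, hdT.1⟩, adelicVal_injective F E c N _ ?_⟩
  rw [adelicVal_torusPart]
  ext i j
  change algebraMap E (AdeleRing (𝓞 E) E) ((glDiagonal N E d : Matrix (Fin N) (Fin N) E) i j) = _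
  rw [coe_glDiagonal, coe_glDiagonal, Matrix.diagonal_apply, Matrix.diagonal_apply]
  split_ifs with h
  · subst h
    rw [hd, coe_diagUnit, ← hγ]
    rfl
  · exact map_zero _

/-- **The unipotent part of a rational Borel element is rational**: `(torusPart b)⁻¹ b ∈ G(F)` (so in
`N(F)`) for `b ∈ B(F)`. [cite: Rogawski1990, §1.10] -/
theorem torusPart_inv_mul_mem_arithmeticSubgroup {b : borelAdelic F E c N}
    (hb : (b : (quasiSplit F E c N).Adelic) ∈ (quasiSplit F E c N).arithmeticSubgroup) :
    (((torusPart b)⁻¹ * b : borelAdelic F E c N) : (quasiSplit F E c N).Adelic) ∈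
      (quasiSplit F E c N).arithmeticSubgroup := by
  rw [Subgroup.coe_mul, Subgroup.coe_inv]
  exact Subgroup.mul_mem _ (Subgroup.inv_mem _ (torusPart_mem_arithmeticSubgroup hb)) hb

/-- **The torus part of `t m` is `t`** (`t ∈ T(𝔸_F)`, `m ∈ N(𝔸_F)`). [cite: Rogawski1990, §1.10] -/
theorem torusPart_mul_of_mem_torusAdelic_of_mem_adelicUnipotent {t m : (quasiSplit F E c N).Adelic}
    (ht : t ∈ torusAdelic F E c N) (hm : m ∈ adelicUnipotent F E c N) :
    torusPart ⟨t * m, Subgroup.mul_mem _ (torusAdelic_le_borelAdelic ht) (adelicUnipotent_le_borelAdelic hm)⟩ =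
      ⟨t, torusAdelic_le_borelAdelic ht⟩ := by
  have h : (⟨t * m, Subgroup.mul_mem _ (torusAdelic_le_borelAdelic ht)
      (adelicUnipotent_le_borelAdelic hm)⟩ : borelAdelic F E c N) =
      ⟨t, torusAdelic_le_borelAdelic ht⟩ * ⟨m, adelicUnipotent_le_borelAdelic hm⟩ := rfl
  rw [h, torusPart_mul, torusPart_eq_self_of_mem (b := ⟨t, torusAdelic_le_borelAdelic ht⟩) ht,
    torusPart_eq_one_of_mem (u := ⟨m, adelicUnipotent_le_borelAdelic hm⟩) hm, mul_one]

/-- **`B(F) = T(F) N(F)` with uniqueness**: there is a bijection `e : B(F) ≃ T(F) × N(F)` with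
`e⁻¹ (t, n) = t n` (existence packaged as a proposition; `e β = (torusPart β, (torusPart β)⁻¹ β)`).
[cite: Rogawski1990, §1.10] -/
theorem exists_equiv_arithmeticBorel_prod :
    ∃ e : arithmeticBorel F E c N ≃ rationalTorus F E c N × rationalUnipotent F E c N,
      ∀ p : rationalTorus F E c N × rationalUnipotent F E c N,
        (((e.symm p : arithmeticBorel F E c N) : (quasiSplit F E c N).arithmeticSubgroup) :
            (quasiSplit F E c N).Adelic) =
          ((p.1 : torusAdelic F E c N) : (quasiSplit F E c N).Adelic) *
            ((p.2 : adelicUnipotent F E c N) : (quasiSplit F E c N).Adelic) := by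
  -- the multiplication map `(t, n) ↦ t n`
  let m : rationalTorus F E c N × rationalUnipotent F E c N → arithmeticBorel F E c N := fun p =>
    ⟨⟨((p.1 : torusAdelic F E c N) : (quasiSplit F E c N).Adelic) *
        ((p.2 : adelicUnipotent F E c N) : (quasiSplit F E c N).Adelic),
      Subgroup.mul_mem _ p.1.2 p.2.2⟩,
      (mem_arithmeticBorel_iff _).2 (Subgroup.mul_mem _ (torusAdelic_le_borelAdelic p.1.1.2)
        (adelicUnipotent_le_borelAdelic p.2.1.2))⟩
  have hm : ∀ p, (((m p : arithmeticBorel F E c N) : (quasiSplit F E c N).arithmeticSubgroup) :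
      (quasiSplit F E c N).Adelic) =
        ((p.1 : torusAdelic F E c N) : (quasiSplit F E c N).Adelic) *
          ((p.2 : adelicUnipotent F E c N) : (quasiSplit F E c N).Adelic) := fun p => rfl
  refine ⟨(Equiv.ofBijective m ⟨?_, ?_⟩).symm, fun p => hm p⟩
  · -- injective: `T(𝔸_F) ∩ N(𝔸_F) = 1`
    rintro ⟨t, n⟩ ⟨t', n'⟩ h
    have h1 : ((t : torusAdelic F E c N) : (quasiSplit F E c N).Adelic) *
        ((n : adelicUnipotent F E c N) : (quasiSplit F E c N).Adelic) =
          ((t' : torusAdelic F E c N) : (quasiSplit F E c N).Adelic) *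
            ((n' : adelicUnipotent F E c N) : (quasiSplit F E c N).Adelic) := by
      have h' := congrArg (fun β : arithmeticBorel F E c N =>
        (((β : (quasiSplit F E c N).arithmeticSubgroup)) : (quasiSplit F E c N).Adelic)) h
      exact h'
    have h2 : (((t' : torusAdelic F E c N) : (quasiSplit F E c N).Adelic))⁻¹ *
        ((t : torusAdelic F E c N) : (quasiSplit F E c N).Adelic) =
          ((n' : adelicUnipotent F E c N) : (quasiSplit F E c N).Adelic) *
            (((n : adelicUnipotent F E c N) : (quasiSplit F E c N).Adelic))⁻¹ := by
      calc (((t' : torusAdelic F E c N) : (quasiSplit F E c N).Adelic))⁻¹ *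
            ((t : torusAdelic F E c N) : (quasiSplit F E c N).Adelic)
          = (((t' : torusAdelic F E c N) : (quasiSplit F E c N).Adelic))⁻¹ *
              (((t : torusAdelic F E c N) : (quasiSplit F E c N).Adelic) *
                ((n : adelicUnipotent F E c N) : (quasiSplit F E c N).Adelic)) *
              (((n : adelicUnipotent F E c N) : (quasiSplit F E c N).Adelic))⁻¹ := by
            simp only [mul_assoc, mul_inv_cancel, mul_one]
        _ = (((t' : torusAdelic F E c N) : (quasiSplit F E c N).Adelic))⁻¹ *
              (((t' : torusAdelic F E c N) : (quasiSplit F E c N).Adelic) *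
                ((n' : adelicUnipotent F E c N) : (quasiSplit F E c N).Adelic)) *
              (((n : adelicUnipotent F E c N) : (quasiSplit F E c N).Adelic))⁻¹ := by rw [h1]
        _ = ((n' : adelicUnipotent F E c N) : (quasiSplit F E c N).Adelic) *
            (((n : adelicUnipotent F E c N) : (quasiSplit F E c N).Adelic))⁻¹ := by
            rw [inv_mul_cancel_left]
    have hT : (((t' : torusAdelic F E c N) : (quasiSplit F E c N).Adelic))⁻¹ *
        ((t : torusAdelic F E c N) : (quasiSplit F E c N).Adelic) ∈ torusAdelic F E c N :=
      Subgroup.mul_mem _ (Subgroup.inv_mem _ t'.1.2) t.1.2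
    have hN : (((t' : torusAdelic F E c N) : (quasiSplit F E c N).Adelic))⁻¹ *
        ((t : torusAdelic F E c N) : (quasiSplit F E c N).Adelic) ∈ adelicUnipotent F E c N := by
      rw [h2]
      exact Subgroup.mul_mem _ n'.1.2 (Subgroup.inv_mem _ n.1.2)
    have hone : (((t' : torusAdelic F E c N) : (quasiSplit F E c N).Adelic))⁻¹ *
        ((t : torusAdelic F E c N) : (quasiSplit F E c N).Adelic) = 1 := by
      have hmem := Subgroup.mem_inf.2 ⟨hT, hN⟩
      rw [torusAdelic_inf_adelicUnipotent_eq_bot] at hmem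
      exact Subgroup.mem_bot.1 hmem
    have htt : t = t' :=
      Subtype.ext (Subtype.ext (inv_mul_eq_one.1 hone).symm)
    subst htt
    have hnn : n = n' := Subtype.ext (Subtype.ext (mul_left_cancel h1))
    rw [hnn]
  · -- surjective: `β = torusPart β · ((torusPart β)⁻¹ β)`
    intro β
    have hbB : ((β : (quasiSplit F E c N).arithmeticSubgroup) : (quasiSplit F E c N).Adelic) ∈
        borelAdelic F E c N := (mem_arithmeticBorel_iff _).1 β.2
    set b : borelAdelic F E c N := ⟨_, hbB⟩ with hb
    have hβ : (b : (quasiSplit F E c N).Adelic) ∈ (quasiSplit F E c N).arithmeticSubgroup :=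
      (β : (quasiSplit F E c N).arithmeticSubgroup).2
    have ht : ((torusPart b : borelAdelic F E c N) : (quasiSplit F E c N).Adelic) ∈ torusAdelic F E c N :=
      torusPart_mem_torusAdelic b
    have htr : (⟨_, ht⟩ : torusAdelic F E c N) ∈ rationalTorus F E c N :=
      Subgroup.mem_comap.2 (torusPart_mem_arithmeticSubgroup hβ)
    have hn : (((torusPart b)⁻¹ * b : borelAdelic F E c N) : (quasiSplit F E c N).Adelic) ∈
        adelicUnipotent F E c N := torusPart_inv_mul_mem_adelicUnipotent b
    have hnr : (⟨_, hn⟩ : adelicUnipotent F E c N) ∈ rationalUnipotent F E c N :=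
      Subgroup.mem_comap.2 (torusPart_inv_mul_mem_arithmeticSubgroup hβ)
    refine ⟨(⟨_, htr⟩, ⟨_, hnr⟩), Subtype.ext (Subtype.ext ?_)⟩
    rw [hm]
    change ((torusPart b : borelAdelic F E c N) : (quasiSplit F E c N).Adelic) *
        (((torusPart b)⁻¹ * b : borelAdelic F E c N) : (quasiSplit F E c N).Adelic) =
      (b : (quasiSplit F E c N).Adelic)
    rw [← Subgroup.coe_mul, mul_inv_cancel_left]

/-! ## §2 The rational Borel sum fibres over the rational torus -/

/-- **`Σ_{β ∈ B(F)} f(x⁻¹ β z) = Σ_{(t, n) ∈ T(F) × N(F)} f(x⁻¹ t n z)`** (re-indexing the rational Borel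
sum ★ `borelSum` along `B(F) = T(F) N(F)`; unconditional sums on both sides).
[cite: Rogawski1990, §2.2 (p. 13)] -/
theorem borelSum_eq_tsum_prod (f : (quasiSplit F E c N).Adelic → ℂ) (x z : (quasiSplit F E c N).Adelic) :
    borelSum f x z = ∑' p : rationalTorus F E c N × rationalUnipotent F E c N,
      f (x⁻¹ * ((p.1 : torusAdelic F E c N) : (quasiSplit F E c N).Adelic) *
        ((p.2 : adelicUnipotent F E c N) : (quasiSplit F E c N).Adelic) * z) := by
  obtain ⟨e, he⟩ := exists_equiv_arithmeticBorel_prod (F := F) (E := E) (c := c) (N := N)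
  rw [borelSum_def, ← e.symm.tsum_eq]
  exact tsum_congr fun p => by rw [he p, ← mul_assoc]

/-- For `f` of compact support the family `(t, n) ↦ f(x⁻¹ t n z)` on `T(F) × N(F)` has finite support
(★ `finite_support_borelSum_term` transported along `B(F) = T(F) N(F)`). [cite: Rogawski1990, §2.2 (p. 13)] -/
theorem finite_support_borelSum_prod_term {f : (quasiSplit F E c N).Adelic → ℂ} (hf : HasCompactSupport f)
    (x z : (quasiSplit F E c N).Adelic) :
    (Function.support fun p : rationalTorus F E c N × rationalUnipotent F E c N =>
      f (x⁻¹ * ((p.1 : torusAdelic F E c N) : (quasiSplit F E c N).Adelic) *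
        ((p.2 : adelicUnipotent F E c N) : (quasiSplit F E c N).Adelic) * z)).Finite := by
  obtain ⟨e, he⟩ := exists_equiv_arithmeticBorel_prod (F := F) (E := E) (c := c) (N := N)
  have hfun : (fun p : rationalTorus F E c N × rationalUnipotent F E c N =>
      f (x⁻¹ * ((p.1 : torusAdelic F E c N) : (quasiSplit F E c N).Adelic) *
        ((p.2 : adelicUnipotent F E c N) : (quasiSplit F E c N).Adelic) * z)) =
      (fun β : arithmeticBorel F E c N =>
        f (x⁻¹ * (((β : (quasiSplit F E c N).arithmeticSubgroup)) : (quasiSplit F E c N).Adelic) * z)) ∘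
          e.symm := by
    funext p
    simp only [Function.comp_apply, he p, mul_assoc]
  rw [hfun, Function.support_comp_eq_preimage]
  exact (finite_support_borelSum_term hf x z).preimage e.symm.injective.injOn

/-- Summability of the family `(t, n) ↦ f(x⁻¹ t n z)` for `f` of compact support. [cite: Rogawski1990, §2.2 (p. 13)] -/
theorem summable_borelSum_prod_term {f : (quasiSplit F E c N).Adelic → ℂ} (hf : HasCompactSupport f)
    (x z : (quasiSplit F E c N).Adelic) :
    Summable fun p : rationalTorus F E c N × rationalUnipotent F E c N =>
      f (x⁻¹ * ((p.1 : torusAdelic F E c N) : (quasiSplit F E c N).Adelic) *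
        ((p.2 : adelicUnipotent F E c N) : (quasiSplit F E c N).Adelic) * z) :=
  summable_of_hasFiniteSupport (finite_support_borelSum_prod_term hf x z)

/-- **`Σ_{β ∈ B(F)} f(x⁻¹ β z) = Σ_{t ∈ T(F)} Σ_{n ∈ N(F)} f(x⁻¹ t n z)`** for `f` of compact support
(Rogawski (1990), §2.2: the `P = B` kernel sums over `M_P = T` and `N`). [cite: Rogawski1990, §2.2 (p. 13)] -/
theorem borelSum_eq_tsum_tsum {f : (quasiSplit F E c N).Adelic → ℂ} (hf : HasCompactSupport f)
    (x z : (quasiSplit F E c N).Adelic) :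
    borelSum f x z = ∑' t : rationalTorus F E c N, ∑' n : rationalUnipotent F E c N,
      f (x⁻¹ * ((t : torusAdelic F E c N) : (quasiSplit F E c N).Adelic) *
        ((n : adelicUnipotent F E c N) : (quasiSplit F E c N).Adelic) * z) := by
  rw [borelSum_eq_tsum_prod]
  exact (summable_borelSum_prod_term hf x z).tsum_prod

/-! ## §3 Only finitely many torus fibres meet a compact set -/

/-- **Only finitely many torus fibres meet the support**: for `f` of compact support on `U(J_N)(𝔸_F)`
and `x, y`, the set of `t ∈ T(F)` with `f(x⁻¹ t m y) ≠ 0` for some `m ∈ N(𝔸_F)` is finite — such `t`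
are the torus parts (★ `torusPart`, continuous) of the compact `B(𝔸_F) ∩ x · supp(f) · y⁻¹`
(`B(𝔸_F)` is closed, ★ `isClosed_borelAdelic`) and lie in the discrete `G(F)`
(★ `finite_setOf_mem_arithmeticSubgroup_of_isCompact`). [cite: Rogawski1990, §2.2 (p. 13)] -/
theorem finite_setOf_rationalTorus_meets_support {f : (quasiSplit F E c N).Adelic → ℂ}
    (hf : HasCompactSupport f) (x y : (quasiSplit F E c N).Adelic) :
    {t : rationalTorus F E c N | ∃ m : adelicUnipotent F E c N,
      f (x⁻¹ * ((t : torusAdelic F E c N) : (quasiSplit F E c N).Adelic) *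
        ((m : adelicUnipotent F E c N) : (quasiSplit F E c N).Adelic) * y) ≠ 0}.Finite := by
  -- the compact set of torus parts of `B(𝔸_F) ∩ {g | x⁻¹ g y ∈ supp f}`
  set K : Set (quasiSplit F E c N).Adelic :=
    (fun g : (quasiSplit F E c N).Adelic => x⁻¹ * g * y) ⁻¹' tsupport f with hK
  have hKc : IsCompact K := by
    let eh : (quasiSplit F E c N).Adelic ≃ₜ (quasiSplit F E c N).Adelic :=
      (Homeomorph.mulLeft x⁻¹).trans (Homeomorph.mulRight y)
    have : K = eh ⁻¹' tsupport f := rfl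
    rw [this]
    exact eh.isCompact_preimage.2 hf
  have hKB : IsCompact ((Subtype.val : borelAdelic F E c N → (quasiSplit F E c N).Adelic) ⁻¹' K) :=
    isClosed_borelAdelic.isClosedEmbedding_subtypeVal.isCompact_preimage hKc
  have hC : IsCompact ((Subtype.val : borelAdelic F E c N → (quasiSplit F E c N).Adelic) ''
      (torusPart '' ((Subtype.val : borelAdelic F E c N → (quasiSplit F E c N).Adelic) ⁻¹' K))) :=
    (hKB.image continuous_torusPart).image continuous_subtype_val
  have hfin := finite_setOf_mem_arithmeticSubgroup_of_isCompact hC 1 1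
  -- `T(F) ↪ G(F)`
  have hι : Function.Injective fun t : rationalTorus F E c N =>
      (⟨((t : torusAdelic F E c N) : (quasiSplit F E c N).Adelic), t.2⟩ :
        (quasiSplit F E c N).arithmeticSubgroup) := fun a a' h =>
    Subtype.ext (Subtype.ext (congrArg
      (fun z : (quasiSplit F E c N).arithmeticSubgroup => (z : (quasiSplit F E c N).Adelic)) h))
  refine (hfin.preimage hι.injOn).subset ?_
  rintro t ⟨m, hm⟩
  change (1 : (quasiSplit F E c N).Adelic)⁻¹ * ((t : torusAdelic F E c N) : (quasiSplit F E c N).Adelic) * 1 ∈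
    (Subtype.val : borelAdelic F E c N → (quasiSplit F E c N).Adelic) ''
      (torusPart '' ((Subtype.val : borelAdelic F E c N → (quasiSplit F E c N).Adelic) ⁻¹' K))
  rw [inv_one, one_mul, mul_one]
  have htB := torusAdelic_le_borelAdelic t.1.2
  have hbB : ((t : torusAdelic F E c N) : (quasiSplit F E c N).Adelic) *
      ((m : adelicUnipotent F E c N) : (quasiSplit F E c N).Adelic) ∈ borelAdelic F E c N :=
    Subgroup.mul_mem _ htB (adelicUnipotent_le_borelAdelic m.2)
  refine ⟨torusPart ⟨_, hbB⟩, ⟨⟨_, hbB⟩, ?_, rfl⟩, ?_⟩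
  · -- `x⁻¹ (t m) y ∈ supp f`
    change x⁻¹ * (((t : torusAdelic F E c N) : (quasiSplit F E c N).Adelic) *
      ((m : adelicUnipotent F E c N) : (quasiSplit F E c N).Adelic)) * y ∈ tsupport f
    rw [← mul_assoc]
    exact subset_tsupport _ hm
  · rw [torusPart_mul_of_mem_torusAdelic_of_mem_adelicUnipotent t.1.2 m.2]

end UnitaryGroup

end Literature.NumberTheory.Automorphic
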